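import Summits.AtomisticToContinuum.HydrodynamicLimit.Theorems.AntiMazurCoboundariesCellForecastPressureDecayEnskogObjects
import HarnessLib

/-!
# S2c(E) · averaging over rotations: pointwise near-constancy on a shell from weak isotropy
# (piece of stub `stub_contactStatistics`, crux line `enskog-compensator-martingale`,
# crux `CellForecastPressureDecay`, stmt-AtomisticToContinuum-13915)

An elementary real-analysis lemma on `ℝ³`, the hinge between the two halves of the proof of the near-contact pair
statistics `ContactStatistics` of the line. The fitting probability `F` of a ghost sphere (the normalised pair
density of the cell, companion file `…Ghost`) is known to be (i) Lipschitz up to `A/L` on the region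
`σ ≤ ‖q‖ ≤ σ + 3` (moving the ghost, companion file `…Reduction`) and (ii) WEAKLY ISOTROPIC:
`|∫ ψ F − ∫ (ψ ∘ g) F| ≤ (K/L) ∫|ψ|` for linear isometries `g` and bounded measurable `ψ` supported in
`‖q‖ ≤ σ + 3` (the cluster expansion, companion files `…Expansion/TreeBound/Tail`). This file shows that (i) and (ii)
make `F` constant on the unit contact shell up to `(3A + K + 4B)/L + B(‖q‖ − σ)` (`ghost_near_const`): compare
`F(q)` with its average over the ball of radius `1/L` centred at `(‖q‖ + 1/L) q̂` (inside `‖·‖ ≥ σ`), carry the ball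
to a reference direction `e₀` by the reflection exchanging `q̂` and `e₀` (`Submodule.reflection_sub`; Lebesgue measure
is invariant, `LinearIsometryEquiv.measurePreserving`), and move radially to contact.

References: folklore (averaging argument); D. Ruelle, *Statistical Mechanics: Rigorous Results* (1969), §4.2 for
the context.
-/

noncomputable section

open MeasureTheory ProbabilityTheory Set Filter Metric
open scoped ENNReal BigOperators InnerProductSpace
open Literature.Analysis.FluidPDE Literature.MathematicalPhysics.KineticTheory

namespace Summit.AtomisticToContinuum.HydrodynamicLimit.Theorems.EnskogCompensator

/-! ## Averaging over rotations -/

/-- A bounded measurable function is integrable on a set of finite measure. [folklore] -/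
theorem integrableOn_of_abs_le {F : V3 → ℝ} (hFm : Measurable F) {b : ℝ} (hFb : ∀ z, |F z| ≤ b) {U : Set V3}
    (hUfin : volume U ≠ ⊤) : IntegrableOn F U volume := by
  haveI : IsFiniteMeasure (volume.restrict U) := ⟨by rwa [Measure.restrict_apply_univ, lt_top_iff_ne_top]⟩
  exact Integrable.mono' (integrable_const b) hFm.aestronglyMeasurable
    (Eventually.of_forall fun z => (Real.norm_eq_abs _).le.trans (hFb z))

/-- **Averaging**: `|F(p) vol(U) − ∫_U F| ≤ M vol(U)` if `|F(p) − F(z)| ≤ M` on `U`. [folklore] -/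
theorem abs_mul_measureReal_sub_setIntegral_le {F : V3 → ℝ} (hFm : Measurable F) (hFb : ∀ z, |F z| ≤ 1)
    {U : Set V3} (hUfin : volume U ≠ ⊤) {p : V3} {M : ℝ} (hM : ∀ z ∈ U, |F p - F z| ≤ M) :
    |F p * volume.real U - ∫ z in U, F z| ≤ M * volume.real U := by
  have hint : IntegrableOn F U volume := integrableOn_of_abs_le hFm hFb hUfin
  have h1 : F p * volume.real U = ∫ _ in U, F p := by rw [setIntegral_const, smul_eq_mul, mul_comm]
  have hc : IntegrableOn (fun _ => F p) U volume := integrableOn_const hUfin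
  rw [h1, ← integral_sub hc.integrable hint.integrable]
  calc |∫ z in U, (F p - F z)| = ‖∫ z in U, (F p - F z)‖ := (Real.norm_eq_abs _).symm
    _ ≤ M * volume.real U :=
        norm_setIntegral_le_of_norm_le_const hUfin.lt_top fun z hz => by rw [Real.norm_eq_abs]; exact hM z hz

/-- **Pointwise near-constancy on the shell by averaging over rotations.** Let `0 ≤ F ≤ 1` be measurable on `ℝ³`,
Lipschitz up to `A/L` on `σ ≤ ‖q‖ ≤ σ + 3` (`|F q − F q'| ≤ A/L + B‖q − q'‖`) and weakly isotropic
(`|∫ ψ F − ∫ (ψ ∘ g) F| ≤ (K/L) ∫|ψ|` for linear isometries `g` and bounded measurable `ψ` supported in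
`‖q‖ ≤ σ + 3`). Then for `σ ≤ ‖q‖ ≤ σ + 1`, `|F(q) − F(σ e₀)| ≤ (3A + K + 4B)/L + B(‖q‖ − σ)`: compare `F(q)` with its
average over the ball of radius `1/L` centred at `(‖q‖ + 1/L) q̂` (which stays in `‖·‖ ≥ σ`), carry the ball to the
reference direction `e₀` by the reflection exchanging `q̂` and `e₀`, and move radially to contact. [folklore] -/
theorem ghost_near_const {F : V3 → ℝ} (hFm : Measurable F) (hF0 : ∀ z, 0 ≤ F z) (hF1 : ∀ z, F z ≤ 1)
    {σ L A B K : ℝ} (hσ : 0 < σ) (hL : 1 ≤ L) (hB : 0 ≤ B)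
    (hlip : ∀ q q' : V3, σ ≤ ‖q‖ → σ ≤ ‖q'‖ → ‖q‖ ≤ σ + 3 → ‖q'‖ ≤ σ + 3 → |F q - F q'| ≤ A / L + B * ‖q - q'‖)
    (hiso : ∀ (g : V3 ≃ₗᵢ[ℝ] V3) (ψ : V3 → ℝ), Measurable ψ → (∀ q, |ψ q| ≤ 1) → (∀ q, ψ q ≠ 0 → ‖q‖ ≤ σ + 3) →
      |(∫ q, ψ q * F q) - ∫ q, ψ (g q) * F q| ≤ K / L * ∫ q, |ψ q|)
    {e₀ : V3} (he₀ : ‖e₀‖ = 1) {q : V3} (hq : σ ≤ ‖q‖) (hq1 : ‖q‖ ≤ σ + 1) :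
    |F q - F (σ • e₀)| ≤ (3 * A + K + 4 * B) / L + B * (‖q‖ - σ) := by
  have hL0 : 0 < L := by linarith
  have hFb : ∀ z, |F z| ≤ 1 := fun z => by rw [abs_of_nonneg (hF0 z)]; exact hF1 z
  set ε : ℝ := 1 / L with hε
  have hε0 : 0 < ε := by positivity
  have hε1 : ε ≤ 1 := by rw [hε, div_le_one hL0]; exact hL
  have hqpos : 0 < ‖q‖ := hσ.trans_le hq
  -- the unit direction, the reflection carrying it to `e₀`, the averaging ball
  set u : V3 := ‖q‖⁻¹ • q with hu
  have hu1 : ‖u‖ = 1 := by rw [hu, norm_smul, norm_inv, norm_norm, inv_mul_cancel₀ hqpos.ne']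
  have hqu : q = ‖q‖ • u := by rw [hu, smul_smul, mul_inv_cancel₀ hqpos.ne', one_smul]
  set g : V3 ≃ₗᵢ[ℝ] V3 := (ℝ ∙ (u - e₀))ᗮ.reflection with hg
  have hgu : g u = e₀ := Submodule.reflection_sub (by rw [hu1, he₀])
  have hgq : g q = ‖q‖ • e₀ := by
    rw [show g q = g (‖q‖ • u) from congrArg g hqu, map_smul, hgu]
  set c : V3 := (‖q‖ + ε) • u with hc
  have hUm : MeasurableSet (ball c ε) := measurableSet_ball
  have hUfin : volume (ball c ε) ≠ ⊤ := measure_ball_lt_top.ne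
  have hUpos : 0 < volume.real (ball c ε) := by
    rw [measureReal_def, ENNReal.toReal_pos_iff]
    exact ⟨measure_ball_pos volume c hε0, measure_ball_lt_top⟩
  have hcq : ‖c - q‖ = ε := by
    rw [hqu, hc, ← sub_smul, add_sub_cancel_left, norm_smul, hu1, mul_one, Real.norm_eq_abs, abs_of_pos hε0]
  have hcn : ‖c‖ = ‖q‖ + ε := by rw [hc, norm_smul, hu1, mul_one, Real.norm_eq_abs, abs_of_pos (by positivity)]
  -- points of the ball: in the region `σ ≤ ‖·‖ ≤ σ + 3`, within `2ε` of `q`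
  have hUmem : ∀ z ∈ ball c ε, σ ≤ ‖z‖ ∧ ‖z‖ ≤ σ + 3 ∧ ‖q - z‖ ≤ 2 * ε := by
    intro z hz
    rw [mem_ball, dist_eq_norm] at hz
    have h1 : ‖q‖ ≤ ‖z‖ := by
      have := norm_sub_norm_le c z
      rw [hcn] at this
      have h2 : ‖c - z‖ = ‖z - c‖ := norm_sub_rev _ _
      linarith
    have h3 : ‖q - z‖ ≤ 2 * ε := by
      calc ‖q - z‖ ≤ ‖q - c‖ + ‖c - z‖ := norm_sub_le_norm_sub_add_norm_sub _ _ _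
        _ ≤ ε + ε := by rw [norm_sub_rev q c, hcq, norm_sub_rev]; linarith
        _ = 2 * ε := by ring
    refine ⟨hq.trans h1, ?_, h3⟩
    have := norm_le_norm_add_norm_sub' z q
    rw [norm_sub_rev] at this
    linarith
  -- Step 1: `F q` versus its average over the ball
  have hT1 : |F q * volume.real (ball c ε) - ∫ z in ball c ε, F z| ≤ (A / L + B * (2 * ε)) * volume.real (ball c ε) :=
    abs_mul_measureReal_sub_setIntegral_le hFm hFb hUfin fun z hz => by
      obtain ⟨hz1, hz2, hz3⟩ := hUmem z hz
      exact (hlip q z hq hz1 (by linarith) hz2).trans (by nlinarith)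
  -- Step 2: the average over the ball versus the average over its image by `g`
  -- (weak isotropy with `ψ = 𝟙_ball`, isometry `g⁻¹`; the image is `g.symm ⁻¹' ball`)
  have hWm : MeasurableSet (g.symm ⁻¹' ball c ε) := hUm.preimage g.symm.continuous.measurable
  have hWvol : volume (g.symm ⁻¹' ball c ε) = volume (ball c ε) :=
    (g.symm.measurePreserving).measure_preimage hUm.nullMeasurableSet
  have hind : ∀ z, |(ball c ε).indicator (fun _ => (1 : ℝ)) z| ≤ 1 := fun z => by
    by_cases hz : z ∈ ball c ε
    · rw [Set.indicator_of_mem hz]; simp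
    · rw [Set.indicator_of_notMem hz]; simp
  have hT2 : |(∫ z in ball c ε, F z) - ∫ z in g.symm ⁻¹' ball c ε, F z| ≤ K / L * volume.real (ball c ε) := by
    have h := hiso g.symm ((ball c ε).indicator fun _ => (1 : ℝ)) (measurable_const.indicator hUm) hind
      (fun z hz => by
        have hzU : z ∈ ball c ε := by by_contra h'; exact hz (Set.indicator_of_notMem h' _)
        exact (hUmem z hzU).2.1)
    have hl : ∫ z in ball c ε, F z = ∫ z, (ball c ε).indicator (fun _ => (1 : ℝ)) z * F z := by
      rw [← integral_indicator hUm]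
      refine integral_congr_ae (Eventually.of_forall fun z => ?_)
      by_cases hz : z ∈ ball c ε
      · simp only [Set.indicator_of_mem hz, one_mul]
      · simp only [Set.indicator_of_notMem hz, zero_mul]
    have hr : ∫ z in g.symm ⁻¹' ball c ε, F z = ∫ z, (ball c ε).indicator (fun _ => (1 : ℝ)) (g.symm z) * F z := by
      rw [← integral_indicator hWm]
      refine integral_congr_ae (Eventually.of_forall fun z => ?_)
      by_cases hz : g.symm z ∈ ball c ε
      · simp only [Set.indicator_of_mem (show z ∈ g.symm ⁻¹' ball c ε from hz), Set.indicator_of_mem hz, one_mul]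
      · simp only [Set.indicator_of_notMem (show z ∉ g.symm ⁻¹' ball c ε from hz), Set.indicator_of_notMem hz,
          zero_mul]
    have hint : ∫ z, |(ball c ε).indicator (fun _ => (1 : ℝ)) z| = volume.real (ball c ε) := by
      rw [← integral_indicator_one hUm]
      refine integral_congr_ae (Eventually.of_forall fun z => ?_)
      by_cases hz : z ∈ ball c ε
      · simp only [Set.indicator_of_mem hz, Pi.one_apply, abs_one]
      · simp only [Set.indicator_of_notMem hz, abs_zero]
    rw [hl, hr, ← hint]
    exact h
  -- Step 3: the average over the image versus `F (g q)`
  have hT3 : |F (g q) * volume.real (ball c ε) - ∫ z in g.symm ⁻¹' ball c ε, F z| ≤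
      (A / L + B * (2 * ε)) * volume.real (ball c ε) := by
    have hv : volume.real (g.symm ⁻¹' ball c ε) = volume.real (ball c ε) := by
      rw [measureReal_def, measureReal_def, hWvol]
    rw [← hv]
    refine abs_mul_measureReal_sub_setIntegral_le hFm hFb (by rw [hWvol]; exact hUfin) fun z hz => ?_
    have hzw : z = g (g.symm z) := (g.apply_symm_apply z).symm
    obtain ⟨hw1, hw2, hw3⟩ := hUmem (g.symm z) hz
    have hn : ‖z‖ = ‖g.symm z‖ := by conv_lhs => rw [hzw, g.norm_map]
    have hd : ‖g q - z‖ = ‖q - g.symm z‖ := by conv_lhs => rw [hzw, ← map_sub, g.norm_map]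
    have := hlip (g q) z (by rw [g.norm_map]; exact hq) (by rw [hn]; exact hw1)
      (by rw [g.norm_map]; linarith) (by rw [hn]; exact hw2)
    rw [hd] at this
    exact this.trans (by nlinarith)
  -- Step 4: move radially to contact
  have hT4 : |F (g q) - F (σ • e₀)| ≤ A / L + B * (‖q‖ - σ) := by
    have hd : ‖g q - σ • e₀‖ = ‖q‖ - σ := by
      rw [hgq, ← sub_smul, norm_smul, he₀, mul_one, Real.norm_eq_abs, abs_of_nonneg (by linarith)]
    have hσe : ‖σ • e₀‖ = σ := by rw [norm_smul, he₀, mul_one, Real.norm_eq_abs, abs_of_pos hσ]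
    have := hlip (g q) (σ • e₀) (by rw [g.norm_map]; exact hq) (by rw [hσe]) (by rw [g.norm_map]; linarith)
      (by rw [hσe]; linarith)
    rwa [hd] at this
  -- assemble: divide the first three steps by the volume of the ball
  have hsum : |F q - F (g q)| * volume.real (ball c ε) ≤
      (2 * (A / L + B * (2 * ε)) + K / L) * volume.real (ball c ε) := by
    have hx : (F q - F (g q)) * volume.real (ball c ε) =
        (F q * volume.real (ball c ε) - ∫ z in ball c ε, F z) +
          ((∫ z in ball c ε, F z) - ∫ z in g.symm ⁻¹' ball c ε, F z) -
            (F (g q) * volume.real (ball c ε) - ∫ z in g.symm ⁻¹' ball c ε, F z) := by ring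
    rw [← abs_of_pos hUpos, ← abs_mul, hx]
    refine (abs_sub _ _).trans ((add_le_add ((abs_add_le _ _).trans (add_le_add hT1 hT2)) hT3).trans ?_)
    rw [abs_of_pos hUpos]
    linarith
  have hdiv : |F q - F (g q)| ≤ 2 * (A / L + B * (2 * ε)) + K / L := le_of_mul_le_mul_right hsum hUpos
  calc |F q - F (σ • e₀)| ≤ |F q - F (g q)| + |F (g q) - F (σ • e₀)| := abs_sub_le _ _ _
    _ ≤ (2 * (A / L + B * (2 * ε)) + K / L) + (A / L + B * (‖q‖ - σ)) := add_le_add hdiv hT4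
    _ = (3 * A + K + 4 * B) / L + B * (‖q‖ - σ) := by rw [hε]; field_simp; ring

/-! ## The registered sub-goal -/

/-- **Registered sub-goal `stub_contactStatistics_averaging`** (piece of stub `stub_contactStatistics`, S2c, of the
line `enskog-compensator-martingale`): a measurable `0 ≤ F ≤ 1` on `ℝ³` which is Lipschitz up to `A/L` on
`σ ≤ ‖q‖ ≤ σ + 3` and weakly isotropic there (`|∫ ψ F − ∫ (ψ ∘ g) F| ≤ (K/L) ∫|ψ|` for linear isometries `g`,
measurable `|ψ| ≤ 1` supported in `‖q‖ ≤ σ + 3`) is constant on the unit contact shell up to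
`(3A + K + 4B)/L + B(‖q‖ − σ)`. [folklore] -/
theorem stub_contactStatistics_averaging : ∀ (F : V3 → ℝ), Measurable F → (∀ z, 0 ≤ F z) → (∀ z, F z ≤ 1) →
    ∀ (σ L A B K : ℝ), 0 < σ → 1 ≤ L → 0 ≤ B →
    (∀ q q' : V3, σ ≤ ‖q‖ → σ ≤ ‖q'‖ → ‖q‖ ≤ σ + 3 → ‖q'‖ ≤ σ + 3 → |F q - F q'| ≤ A / L + B * ‖q - q'‖) →
    (∀ (g : V3 ≃ₗᵢ[ℝ] V3) (ψ : V3 → ℝ), Measurable ψ → (∀ q, |ψ q| ≤ 1) → (∀ q, ψ q ≠ 0 → ‖q‖ ≤ σ + 3) →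
      |(∫ q, ψ q * F q) - ∫ q, ψ (g q) * F q| ≤ K / L * ∫ q, |ψ q|) →
    ∀ (e₀ : V3), ‖e₀‖ = 1 → ∀ q : V3, σ ≤ ‖q‖ → ‖q‖ ≤ σ + 1 →
    |F q - F (σ • e₀)| ≤ (3 * A + K + 4 * B) / L + B * (‖q‖ - σ) :=
  fun _ hFm hF0 hF1 _ _ _ _ _ hσ hL hB hlip hiso _ he₀ _ hq hq1 =>
    ghost_near_const hFm hF0 hF1 hσ hL hB hlip hiso he₀ hq hq1

end Summit.AtomisticToContinuum.HydrodynamicLimit.Theorems.EnskogCompensator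

end
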